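/-
Copyright (c) 2026 the pub-hodgecm-mathlib formalisation cell (harness21).  Prover seat hodgecm-mathlib-F0P3-p01 (g24); E1 keeper ∕ dealer F0P3a-p03 (g30), E1 BRICK LEDGER
row 59 «K2′∕K4′-UNR ASSEMBLY HEADS» — GLUE F, GENERIC HALF «EP TRACE ONE» of census `CENSUS-R59-K2K4-UNR.v1` §1 (ii)–(iv) (2026-09-03).
-/
import Literature.NumberTheory.Automorphic.SmoothCharacterEPFunctionTrace            -- ★ row 42 p853246: `Representation.smoothTrace_epFunction'`, `epFunction_mem_schwartzBruhat`
import Literature.RepresentationTheory.IntertwiningMapPresentationExtensionSmooth     -- ★ (J′) row 59 GLUE C: `finrank_intertwiningMap_presentation_self_of_isSmooth`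
import HarnessLib

/-!
# The trace of the Euler–Poincaré function of a representation on ITSELF is `1`:
# `tr σ(f_EP^{σ}) = Σ_i (−1)^{d_i} dim Hom_{P_i}(σ^{U_i}, σ) = dim Hom_G(C₀, σ) − dim Hom_G(C₁, σ) = dim Hom_G(σ, σ) = 1` (Schneider–Stuhler 1997 §III.4; Kottwitz 1988 §2)

Topic `NumberTheory/Automorphic`; namespace `Representation` (dot notation, as ★ row 42 `SmoothCharacterEPFunctionTrace`).  THEOREMS ONLY (no definition, no instance, no
notation, no named fact, no `sorry`); generic over a locally compact totally disconnected group `G`, a left-invariant open-positive measure `μ` finite on compacts, an ADMISSIBLE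
SMOOTH representation `ρ` (= `σ`) on a complex vector space `V`, and a LENGTH-ONE SMOOTH PRESENTATION `0 → C₁ —d→ C₀ —ε→ V → 0` (consumer: the Schneider–Stuhler tree complex
★ `shortExact_univ`) whose Hom-counts into `V` are the two halves of the Euler–Poincaré family (consumer: ★ row 45 Frobenius + row 57 «chains = ⊕ c-Ind»).

THE MATHEMATICS.  With ★ row 42's family of `K`-type idempotent functions `f_i = 𝟙_{P_i} χ_{τ_i}(·⁻¹)` (`i ∈ s`, signs `d_i ∈ {0, 1}` = vertex ∕ edge) and
`n_i := dim_ℂ Hom_{P_i}(W_i, σ|_{P_i})`: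
  `tr σ(Σ_i (−1)^{d_i} μ(P_i)⁻¹ f_i) = Σ_i (−1)^{d_i} n_i`                                  (★ 42 `smoothTrace_epFunction'`)
  `= Σ_{d_i = 0} n_i − Σ_{d_i = 1} n_i = dim Hom_G(C₀, σ) − dim Hom_G(C₁, σ)`              (the two BRIDGE hypotheses `h0`, `h1` — Frobenius ★ 45 + «`C_q ≅ ⊕_{d_i = q} c-Ind τ_i`» row 57)
  `= dim Hom_G(σ, σ) = 1`                                                                  (★ (J′) `finrank_intertwiningMap_presentation_self_of_isSmooth`: smooth
                                                                                            self-extensions of `σ` split + Schur «`End_G(σ) = ℂ`»).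
* §1 (bookkeeping) `sum_neg_one_pow_mul_eq_sub_of_forall_le_one` — `Σ_{i∈s} (−1)^{d_i} n_i = Σ_{d_i=0} n_i − Σ_{d_i=1} n_i` in `ℂ` for `d_i ∈ {0,1}`.
* §2 **`smoothTrace_epFunction_eq_one_of_smooth_presentation`** — THE HEAD: `ρ.smoothTrace μ (Σ_{i∈s} (−1)^{d_i} • μ(P_i)⁻¹ • f_i) = 1`.
Consumer (cell `pub/hodgecm-mathlib`, crux H413 = `stmt-HodgeConjecture-24833`, E1 row 59 GLUE F «EP-NORM-ONE @ UNR»): with ★ PCT-OUT `⟨χ_σ, χ_σ⟩_e = Tr σ(f)` for the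
pseudo-coefficient `f = f_EP^{σ,e}` (row 58, witnessed form) this is `⟨χ_σ, χ_σ⟩_e = 1` for every irreducible admissible `σ` at an unramified place whose smooth
self-extensions split (K2′: `σ = π²(ξ)`, ★ 40″; K4′: l.d.s. members, 46″) — NO `L²` ∕ ellipticity antecedent.
HONEST LABEL: count-neutral generic base layer; E1 = PRINT until the charter test; h413 OPEN; HC_CM is proved only modulo the printed citations until rung 0 closes.

## References
* [SchneiderStuhler1997] P. Schneider, U. Stuhler, *Representation theory and sheaves on the Bruhat–Tits building*, Publ. Math. IHÉS 85 (1997), §III.4 (Euler–Poincaré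
  functions: `Tr π′(f_EP^π) = EP(π, π′) = Σ_q (−1)^q dim Ext^q(π, π′)`; Thm. III.4.20 for `π′ = π`).
* [Kottwitz1988] R. E. Kottwitz, *Tamagawa numbers*, Ann. of Math. 127 (1988), §2 (the Euler–Poincaré function).
* [Weibel1994] C. A. Weibel, *An Introduction to Homological Algebra* (1994), §3.4 Thm. 3.4.3.
-/

set_option autoImplicit false

open MeasureTheory Topology
open scoped Pointwise BigOperators

namespace Representation

open Literature.NumberTheory.Automorphic Literature.RepresentationTheory

universe u v w

/-! ## §1 Bookkeeping: an alternating sum with exponents in `{0, 1}` is a difference of two filtered sums -/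

/-- `Σ_{i ∈ s} (−1)^{d_i} · n_i = Σ_{i ∈ s, d_i = 0} n_i − Σ_{i ∈ s, d_i = 1} n_i` in `ℂ` when every `d_i ≤ 1` (vertex ∕ edge dimensions of a TREE). [cite: Kottwitz1988, §2] -/
theorem sum_neg_one_pow_mul_eq_sub_of_forall_le_one {ι : Type w} (s : Finset ι) (d : ι → ℕ) (n : ι → ℕ) (hd : ∀ i ∈ s, d i ≤ 1) :
    ∑ i ∈ s, (-1 : ℂ) ^ d i * (n i : ℂ) =
      (∑ i ∈ s.filter (fun i => d i = 0), (n i : ℂ)) - ∑ i ∈ s.filter (fun i => d i = 1), (n i : ℂ) := by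
  rw [← Finset.sum_filter_add_sum_filter_not s (fun i => d i = 0), sub_eq_add_neg, ← Finset.sum_neg_distrib]
  congr 1
  · exact Finset.sum_congr rfl fun i hi => by rw [(Finset.mem_filter.1 hi).2, pow_zero, one_mul]
  · have hfilt : s.filter (fun i => ¬ d i = 0) = s.filter (fun i => d i = 1) :=
      Finset.filter_congr fun i hi => by constructor <;> intro h <;> have := hd i hi <;> omega
    rw [hfilt]
    exact Finset.sum_congr rfl fun i hi => by rw [(Finset.mem_filter.1 hi).2, pow_one, neg_one_mul]

/-! ## §2 The head: `tr σ(f_EP^σ) = 1` -/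

variable {G : Type u} [TopologicalSpace G] [Group G] [NonarchimedeanGroup G] [LocallyCompactSpace G] [MeasurableSpace G] [BorelSpace G]
  {V : Type v} [AddCommGroup V] [Module ℂ V] (ρ : Representation ℂ G V)
  (μ : Measure G) [μ.IsMulLeftInvariant] [IsFiniteMeasureOnCompacts μ] [μ.IsOpenPosMeasure]

/-- **THE TRACE OF THE EULER–POINCARÉ FUNCTION OF `σ` ON `σ` IS ONE.**  Let `σ = ρ` be admissible and smooth on `V ≠ 0`, `f_i = 𝟙_{P_i} χ_{τ_i}(·⁻¹)` (`i ∈ s`) a finite family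
of `K`-type idempotent functions as in ★ row 42 (`U_i ≤ P_i ≤ N_G(U_i)`, `U_i` compact open, `P_i` compact, `τ_i` finite-dimensional on `W_i`, trivial on `U_i`) with signs
`d_i ≤ 1`, and `0 → C₁ —d→ C₀ —ε→ V → 0` a presentation by `G`-representations with `C₀` smooth, such that (BRIDGES) `dim Hom_G(C₀, σ) = Σ_{d_i=0} dim Hom_{P_i}(W_i, σ)` and
`dim Hom_G(C₁, σ) = Σ_{d_i=1} dim Hom_{P_i}(W_i, σ)`, every SMOOTH self-extension of `σ` splits, and every `G`-endomorphism of `σ` is a scalar.  Then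
`tr σ(Σ_{i∈s} (−1)^{d_i} μ(P_i)⁻¹ f_i) = 1`.  (★ 42 + §1 + the bridges + ★ (J′) `finrank_intertwiningMap_presentation_self_of_isSmooth`.)
[cite: SchneiderStuhler1997, §III.4] [cite: Kottwitz1988, §2] [cite: Weibel1994, §3.4 Thm. 3.4.3] -/
theorem smoothTrace_epFunction_eq_one_of_smooth_presentation [Nontrivial V] (hadm : ρ.IsAdmissible) (hV : ρ.IsSmooth)
    -- ★ row 42's family
    {ι : Type w} (s : Finset ι) (U P : ι → Subgroup G) {W : ι → Type*} [∀ i, AddCommGroup (W i)] [∀ i, Module ℂ (W i)] [∀ i, FiniteDimensional ℂ (W i)]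
    (τ : ∀ i, Representation ℂ (P i) (W i)) (f : ι → G → ℂ) (d : ι → ℕ)
    (hUo : ∀ i ∈ s, IsOpen (U i : Set G)) (hUc : ∀ i ∈ s, IsCompact (U i : Set G)) (hPc : ∀ i ∈ s, IsCompact (P i : Set G))
    (hUP : ∀ i, U i ≤ P i) (hPU : ∀ i ∈ s, P i ≤ Subgroup.normalizer (U i : Set G))
    (hτ : ∀ i ∈ s, ∀ (u : G) (hu : u ∈ U i), τ i ⟨u, hUP i hu⟩ = 1)
    (hfP : ∀ i ∈ s, ∀ (g : G) (hg : g ∈ P i), f i g = (τ i).character ⟨g, hg⟩⁻¹) (hf0 : ∀ i ∈ s, ∀ g ∉ P i, f i g = 0)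
    (hd1 : ∀ i ∈ s, d i ≤ 1)
    -- the smooth length-one presentation of `V` (★ (J′) letters) and its two BRIDGES to the family
    {M₁ M₀ : Type v} [AddCommGroup M₁] [Module ℂ M₁] [AddCommGroup M₀] [Module ℂ M₀] (ρ₁ : Representation ℂ G M₁) (ρ₀ : Representation ℂ G M₀)
    (dC : IntertwiningMap ρ₁ ρ₀) (ε : IntertwiningMap ρ₀ ρ) (h₀ : ρ₀.IsSmooth)
    (hd : Function.Injective dC) (hexact : LinearMap.ker ε.toLinearMap = LinearMap.range dC.toLinearMap) (hε : Function.Surjective ε)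
    [FiniteDimensional ℂ (IntertwiningMap ρ₀ ρ)]
    (h0 : Module.finrank ℂ (IntertwiningMap ρ₀ ρ) = ∑ i ∈ s.filter (fun i => d i = 0), Module.finrank ℂ (IntertwiningMap (τ i) (ρ.comp (P i).subtype)))
    (h1 : Module.finrank ℂ (IntertwiningMap ρ₁ ρ) = ∑ i ∈ s.filter (fun i => d i = 1), Module.finrank ℂ (IntertwiningMap (τ i) (ρ.comp (P i).subtype)))
    -- smooth self-extensions of `V` split; Schur
    (hsplit : ∀ (E : Type v) [AddCommGroup E] [Module ℂ E] (ρE : Representation ℂ G E), ρE.IsSmooth → ∀ (i : IntertwiningMap ρ ρE) (p : IntertwiningMap ρE ρ),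
      Function.Injective i → LinearMap.ker p.toLinearMap = LinearMap.range i.toLinearMap → Function.Surjective p → ∃ sV : IntertwiningMap ρ ρE, p.comp sV = IntertwiningMap.id ρ)
    (hschur : ∀ T : IntertwiningMap ρ ρ, ∃ c : ℂ, T.toLinearMap = c • LinearMap.id) :
    ρ.smoothTrace μ (∑ i ∈ s, ((-1 : ℂ) ^ d i) • ((μ.real (P i : Set G) : ℂ))⁻¹ • f i) = 1 := by
  rw [ρ.smoothTrace_epFunction' μ s U P τ f d hadm hUo hUc hPc hUP hPU hτ hfP hf0,
    sum_neg_one_pow_mul_eq_sub_of_forall_le_one s d _ hd1]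
  have hcount := finrank_intertwiningMap_presentation_self_of_isSmooth ρ₁ ρ₀ ρ dC ε h₀ hV hd hexact hε hsplit hschur
  rw [h0, h1] at hcount
  have hcast : ((∑ i ∈ s.filter (fun i => d i = 0), Module.finrank ℂ (IntertwiningMap (τ i) (ρ.comp (P i).subtype)) : ℕ) : ℂ) =
      ((1 + ∑ i ∈ s.filter (fun i => d i = 1), Module.finrank ℂ (IntertwiningMap (τ i) (ρ.comp (P i).subtype)) : ℕ) : ℂ) := by rw [hcount]
  rw [Nat.cast_sum, Nat.cast_add, Nat.cast_sum, Nat.cast_one] at hcast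
  rw [hcast, add_sub_cancel_right]

/-! ## §3 (ED. 2, append-only) The 3-term currency of a tree with two vertex types and one edge orbit — the cell's 48-datum ∕ row-58 letters
(`f = μ(P₀)⁻¹ • f₀ + μ(P₂)⁻¹ • f₂ − μ(P₁)⁻¹ • f₁`, `τᵢ` trivial on `Uᵢ` in MEMBERSHIP form, bridges `dim Hom_G(C₀, σ) = n₀ + n₂`, `dim Hom_G(C₁, σ) = n₁`; no `Finset`, no dependent family) -/

/-- **`tr σ(μ(P₀)⁻¹ f₀ + μ(P₂)⁻¹ f₂ − μ(P₁)⁻¹ f₁) = 1`** — §2 in the 3-TERM currency: `K`-type idempotent functions `fᵢ = 𝟙_{Pᵢ} χ_{τᵢ}(·⁻¹)` on two vertex stabilisers `P₀`, `P₂`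
and one edge stabiliser `P₁` (`Uᵢ ≤ Pᵢ ≤ N_G(Uᵢ)`, `Uᵢ` compact open, `Pᵢ` compact, `τᵢ` finite-dimensional, trivial on `Uᵢ` — MEMBERSHIP form), a smooth length-one presentation
`0 → C₁ → C₀ → V → 0` of the admissible smooth `σ = ρ` on `V ≠ 0` with BRIDGES `dim Hom_G(C₀, σ) = dim Hom_{P₀}(W₀, σ) + dim Hom_{P₂}(W₂, σ)`, `dim Hom_G(C₁, σ) = dim Hom_{P₁}(W₁, σ)`,
smooth self-extensions of `σ` split, `End_G(σ) = ℂ`.  (★ 42 `smoothTrace_invMeasure_smul_kType` ×3 + ★ CLASS-LINEAR `smoothTrace_add_of_mem` ∕ `smoothTrace_sub_of_mem` + ★ (J′).)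
[cite: SchneiderStuhler1997, §III.4] [cite: Kottwitz1988, §2] [cite: Weibel1994, §3.4 Thm. 3.4.3] -/
theorem smoothTrace_epThree_eq_one_of_smooth_presentation [Nontrivial V] (hadm : ρ.IsAdmissible) (hV : ρ.IsSmooth)
    -- the three `K`-type pieces (48-datum letters)
    {U₀ P₀ U₂ P₂ U₁ P₁ : Subgroup G}
    (hU₀o : IsOpen (U₀ : Set G)) (hU₀c : IsCompact (U₀ : Set G)) (hP₀c : IsCompact (P₀ : Set G)) (hUP₀ : U₀ ≤ P₀) (hPU₀ : P₀ ≤ Subgroup.normalizer (U₀ : Set G))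
    (hU₂o : IsOpen (U₂ : Set G)) (hU₂c : IsCompact (U₂ : Set G)) (hP₂c : IsCompact (P₂ : Set G)) (hUP₂ : U₂ ≤ P₂) (hPU₂ : P₂ ≤ Subgroup.normalizer (U₂ : Set G))
    (hU₁o : IsOpen (U₁ : Set G)) (hU₁c : IsCompact (U₁ : Set G)) (hP₁c : IsCompact (P₁ : Set G)) (hUP₁ : U₁ ≤ P₁) (hPU₁ : P₁ ≤ Subgroup.normalizer (U₁ : Set G))
    {W₀ W₂ W₁ : Type*} [AddCommGroup W₀] [Module ℂ W₀] [FiniteDimensional ℂ W₀] [AddCommGroup W₂] [Module ℂ W₂] [FiniteDimensional ℂ W₂]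
    [AddCommGroup W₁] [Module ℂ W₁] [FiniteDimensional ℂ W₁]
    (τ₀ : Representation ℂ P₀ W₀) (τ₂ : Representation ℂ P₂ W₂) (τ₁ : Representation ℂ P₁ W₁)
    (hτ₀ : ∀ p : ↥P₀, (p : G) ∈ U₀ → τ₀ p = 1) (hτ₂ : ∀ p : ↥P₂, (p : G) ∈ U₂ → τ₂ p = 1) (hτ₁ : ∀ p : ↥P₁, (p : G) ∈ U₁ → τ₁ p = 1)
    {f₀ f₂ f₁ : G → ℂ}
    (hfP₀ : ∀ (g : G) (hg : g ∈ P₀), f₀ g = τ₀.character ⟨g, hg⟩⁻¹) (hf0₀ : ∀ g ∉ P₀, f₀ g = 0)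
    (hfP₂ : ∀ (g : G) (hg : g ∈ P₂), f₂ g = τ₂.character ⟨g, hg⟩⁻¹) (hf0₂ : ∀ g ∉ P₂, f₂ g = 0)
    (hfP₁ : ∀ (g : G) (hg : g ∈ P₁), f₁ g = τ₁.character ⟨g, hg⟩⁻¹) (hf0₁ : ∀ g ∉ P₁, f₁ g = 0)
    -- the smooth length-one presentation of `V` (★ (J′) letters) and its two BRIDGES
    {M₁ M₀ : Type v} [AddCommGroup M₁] [Module ℂ M₁] [AddCommGroup M₀] [Module ℂ M₀] (ρ₁ : Representation ℂ G M₁) (ρ₀ : Representation ℂ G M₀)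
    (dC : IntertwiningMap ρ₁ ρ₀) (ε : IntertwiningMap ρ₀ ρ) (h₀ : ρ₀.IsSmooth)
    (hd : Function.Injective dC) (hexact : LinearMap.ker ε.toLinearMap = LinearMap.range dC.toLinearMap) (hε : Function.Surjective ε)
    [FiniteDimensional ℂ (IntertwiningMap ρ₀ ρ)]
    (h0 : Module.finrank ℂ (IntertwiningMap ρ₀ ρ) =
      Module.finrank ℂ (IntertwiningMap τ₀ (ρ.comp P₀.subtype)) + Module.finrank ℂ (IntertwiningMap τ₂ (ρ.comp P₂.subtype)))
    (h1 : Module.finrank ℂ (IntertwiningMap ρ₁ ρ) = Module.finrank ℂ (IntertwiningMap τ₁ (ρ.comp P₁.subtype)))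
    -- smooth self-extensions of `V` split; Schur
    (hsplit : ∀ (E : Type v) [AddCommGroup E] [Module ℂ E] (ρE : Representation ℂ G E), ρE.IsSmooth → ∀ (i : IntertwiningMap ρ ρE) (p : IntertwiningMap ρE ρ),
      Function.Injective i → LinearMap.ker p.toLinearMap = LinearMap.range i.toLinearMap → Function.Surjective p → ∃ sV : IntertwiningMap ρ ρE, p.comp sV = IntertwiningMap.id ρ)
    (hschur : ∀ T : IntertwiningMap ρ ρ, ∃ c : ℂ, T.toLinearMap = c • LinearMap.id) :
    ρ.smoothTrace μ ((((μ.real (P₀ : Set G) : ℂ))⁻¹ • f₀ + ((μ.real (P₂ : Set G) : ℂ))⁻¹ • f₂) - ((μ.real (P₁ : Set G) : ℂ))⁻¹ • f₁) = 1 := by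
  -- the three pieces are test functions; their volumes are non-zero
  have hτ₀' : ∀ (u : G) (hu : u ∈ U₀), τ₀ ⟨u, hUP₀ hu⟩ = 1 := fun u hu => hτ₀ ⟨u, hUP₀ hu⟩ hu
  have hτ₂' : ∀ (u : G) (hu : u ∈ U₂), τ₂ ⟨u, hUP₂ hu⟩ = 1 := fun u hu => hτ₂ ⟨u, hUP₂ hu⟩ hu
  have hτ₁' : ∀ (u : G) (hu : u ∈ U₁), τ₁ ⟨u, hUP₁ hu⟩ = 1 := fun u hu => hτ₁ ⟨u, hUP₁ hu⟩ hu
  have hm₀ : (((μ.real (P₀ : Set G) : ℂ))⁻¹ • f₀) ∈ SchwartzBruhat G :=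
    Submodule.smul_mem _ _ (mem_schwartzBruhat_of_kType hU₀o hU₀c hP₀c hUP₀ hPU₀ τ₀ hτ₀' hfP₀ hf0₀)
  have hm₂ : (((μ.real (P₂ : Set G) : ℂ))⁻¹ • f₂) ∈ SchwartzBruhat G :=
    Submodule.smul_mem _ _ (mem_schwartzBruhat_of_kType hU₂o hU₂c hP₂c hUP₂ hPU₂ τ₂ hτ₂' hfP₂ hf0₂)
  have hm₁ : (((μ.real (P₁ : Set G) : ℂ))⁻¹ • f₁) ∈ SchwartzBruhat G :=
    Submodule.smul_mem _ _ (mem_schwartzBruhat_of_kType hU₁o hU₁c hP₁c hUP₁ hPU₁ τ₁ hτ₁' hfP₁ hf0₁)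
  rw [ρ.smoothTrace_sub_of_mem μ hadm (Submodule.add_mem _ hm₀ hm₂) hm₁, ρ.smoothTrace_add_of_mem μ hadm hm₀ hm₂,
    ρ.smoothTrace_invMeasure_smul_kType μ hadm hU₀o hU₀c hP₀c hUP₀ hPU₀ (measureReal_ne_zero_of_le μ hU₀o hP₀c hUP₀) τ₀ hτ₀' hfP₀ hf0₀,
    ρ.smoothTrace_invMeasure_smul_kType μ hadm hU₂o hU₂c hP₂c hUP₂ hPU₂ (measureReal_ne_zero_of_le μ hU₂o hP₂c hUP₂) τ₂ hτ₂' hfP₂ hf0₂,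
    ρ.smoothTrace_invMeasure_smul_kType μ hadm hU₁o hU₁c hP₁c hUP₁ hPU₁ (measureReal_ne_zero_of_le μ hU₁o hP₁c hUP₁) τ₁ hτ₁' hfP₁ hf0₁]
  have hcount := finrank_intertwiningMap_presentation_self_of_isSmooth ρ₁ ρ₀ ρ dC ε h₀ hV hd hexact hε hsplit hschur
  rw [h0, h1] at hcount
  have hcast : ((Module.finrank ℂ (IntertwiningMap τ₀ (ρ.comp P₀.subtype)) + Module.finrank ℂ (IntertwiningMap τ₂ (ρ.comp P₂.subtype)) : ℕ) : ℂ) =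
      ((1 + Module.finrank ℂ (IntertwiningMap τ₁ (ρ.comp P₁.subtype)) : ℕ) : ℂ) := by rw [hcount]
  rw [Nat.cast_add, Nat.cast_add, Nat.cast_one] at hcast
  rw [hcast, add_sub_cancel_right]

/-! ## §4 (ED. 2, append-only) The TWO-FAMILY currency `Σ_{vertex orbits} − Σ_{edge orbits}` — the letters of ★ 57-B `SchneiderStuhlerChainsCompactInduction` (`ι₀`, `ι₁`;
`h0`∕`h1` = its `finrank_intertwiningMap_zeroChains_eq_sum` ∕ `…oneChains_eq_sum` VERBATIM) and of ★ 55-A-III's orbit data (`ι₀ = Fin 2`, `ι₁ = Unit` at the `U(3)` datum) -/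

/-- **`tr σ(Σ_i μ(P₀ i)⁻¹ f₀ i − Σ_j μ(P₁ j)⁻¹ f₁ j) = 1`** — §2 in the TWO-FAMILY currency: vertex-orbit pieces `f₀ i = 𝟙_{P₀ i} χ_{τ₀ i}(·⁻¹)` (`i ∈ ι₀`) and edge-orbit pieces
`f₁ j` (`j ∈ ι₁`) (`Uᵢ ≤ Pᵢ ≤ N_G(Uᵢ)`, `Uᵢ` compact open, `Pᵢ` compact, `τᵢ` finite-dimensional, trivial on `Uᵢ` in MEMBERSHIP form), a smooth length-one presentation
`0 → C₁ → C₀ → V → 0` of the admissible smooth `σ = ρ` on `V ≠ 0` whose Hom-counts are ★ 57-B's vertex ∕ edge sums (`h0`, `h1` in exactly that shape), smooth self-extensions of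
`σ` split, `End_G(σ) = ℂ`.  (★ 42 termwise + ★ CLASS-LINEAR `smoothTrace_finset_sum_of_mem`∕`smoothTrace_sub_of_mem` + ★ (J′).)
[cite: SchneiderStuhler1997, §III.4] [cite: Kottwitz1988, §2] [cite: Weibel1994, §3.4 Thm. 3.4.3] -/
theorem smoothTrace_epTwoFamilies_eq_one_of_smooth_presentation [Nontrivial V] (hadm : ρ.IsAdmissible) (hV : ρ.IsSmooth)
    -- vertex-orbit pieces
    {ι₀ : Type*} [Fintype ι₀] (U₀ P₀ : ι₀ → Subgroup G) {W₀ : ι₀ → Type*} [∀ i, AddCommGroup (W₀ i)] [∀ i, Module ℂ (W₀ i)] [∀ i, FiniteDimensional ℂ (W₀ i)]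
    (τ₀ : ∀ i, Representation ℂ (P₀ i) (W₀ i)) (f₀ : ι₀ → G → ℂ)
    (hU₀o : ∀ i, IsOpen (U₀ i : Set G)) (hU₀c : ∀ i, IsCompact (U₀ i : Set G)) (hP₀c : ∀ i, IsCompact (P₀ i : Set G))
    (hUP₀ : ∀ i, U₀ i ≤ P₀ i) (hPU₀ : ∀ i, P₀ i ≤ Subgroup.normalizer (U₀ i : Set G))
    (hτ₀ : ∀ i (p : ↥(P₀ i)), (p : G) ∈ U₀ i → τ₀ i p = 1)
    (hfP₀ : ∀ i (g : G) (hg : g ∈ P₀ i), f₀ i g = (τ₀ i).character ⟨g, hg⟩⁻¹) (hf0₀ : ∀ i, ∀ g ∉ P₀ i, f₀ i g = 0)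
    -- edge-orbit pieces
    {ι₁ : Type*} [Fintype ι₁] (U₁ P₁ : ι₁ → Subgroup G) {W₁ : ι₁ → Type*} [∀ j, AddCommGroup (W₁ j)] [∀ j, Module ℂ (W₁ j)] [∀ j, FiniteDimensional ℂ (W₁ j)]
    (τ₁ : ∀ j, Representation ℂ (P₁ j) (W₁ j)) (f₁ : ι₁ → G → ℂ)
    (hU₁o : ∀ j, IsOpen (U₁ j : Set G)) (hU₁c : ∀ j, IsCompact (U₁ j : Set G)) (hP₁c : ∀ j, IsCompact (P₁ j : Set G))
    (hUP₁ : ∀ j, U₁ j ≤ P₁ j) (hPU₁ : ∀ j, P₁ j ≤ Subgroup.normalizer (U₁ j : Set G))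
    (hτ₁ : ∀ j (p : ↥(P₁ j)), (p : G) ∈ U₁ j → τ₁ j p = 1)
    (hfP₁ : ∀ j (g : G) (hg : g ∈ P₁ j), f₁ j g = (τ₁ j).character ⟨g, hg⟩⁻¹) (hf0₁ : ∀ j, ∀ g ∉ P₁ j, f₁ j g = 0)
    -- the smooth length-one presentation of `V` (★ (J′) letters) and its two BRIDGES in ★ 57-B's shape
    {M₁ M₀ : Type v} [AddCommGroup M₁] [Module ℂ M₁] [AddCommGroup M₀] [Module ℂ M₀] (ρ₁ : Representation ℂ G M₁) (ρ₀ : Representation ℂ G M₀)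
    (dC : IntertwiningMap ρ₁ ρ₀) (ε : IntertwiningMap ρ₀ ρ) (h₀ : ρ₀.IsSmooth)
    (hd : Function.Injective dC) (hexact : LinearMap.ker ε.toLinearMap = LinearMap.range dC.toLinearMap) (hε : Function.Surjective ε)
    [FiniteDimensional ℂ (IntertwiningMap ρ₀ ρ)]
    (h0 : Module.finrank ℂ (ρ₀.IntertwiningMap ρ) = ∑ i, Module.finrank ℂ ((τ₀ i).IntertwiningMap (ρ.comp (P₀ i).subtype)))
    (h1 : Module.finrank ℂ (ρ₁.IntertwiningMap ρ) = ∑ j, Module.finrank ℂ ((τ₁ j).IntertwiningMap (ρ.comp (P₁ j).subtype)))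
    -- smooth self-extensions of `V` split; Schur
    (hsplit : ∀ (E : Type v) [AddCommGroup E] [Module ℂ E] (ρE : Representation ℂ G E), ρE.IsSmooth → ∀ (i : IntertwiningMap ρ ρE) (p : IntertwiningMap ρE ρ),
      Function.Injective i → LinearMap.ker p.toLinearMap = LinearMap.range i.toLinearMap → Function.Surjective p → ∃ sV : IntertwiningMap ρ ρE, p.comp sV = IntertwiningMap.id ρ)
    (hschur : ∀ T : IntertwiningMap ρ ρ, ∃ c : ℂ, T.toLinearMap = c • LinearMap.id) :
    ρ.smoothTrace μ ((∑ i, ((μ.real (P₀ i : Set G) : ℂ))⁻¹ • f₀ i) - ∑ j, ((μ.real (P₁ j : Set G) : ℂ))⁻¹ • f₁ j) = 1 := by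
  -- ★ 42's `hUP`-form of the triviality letters
  have hτ₀' : ∀ i (u : G) (hu : u ∈ U₀ i), τ₀ i ⟨u, hUP₀ i hu⟩ = 1 := fun i u hu => hτ₀ i ⟨u, hUP₀ i hu⟩ hu
  have hτ₁' : ∀ j (u : G) (hu : u ∈ U₁ j), τ₁ j ⟨u, hUP₁ j hu⟩ = 1 := fun j u hu => hτ₁ j ⟨u, hUP₁ j hu⟩ hu
  -- every piece is a test function
  have hm₀ : ∀ i ∈ (Finset.univ : Finset ι₀), (((μ.real (P₀ i : Set G) : ℂ))⁻¹ • f₀ i) ∈ SchwartzBruhat G := fun i _ =>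
    Submodule.smul_mem _ _ (mem_schwartzBruhat_of_kType (hU₀o i) (hU₀c i) (hP₀c i) (hUP₀ i) (hPU₀ i) (τ₀ i) (hτ₀' i) (hfP₀ i) (hf0₀ i))
  have hm₁ : ∀ j ∈ (Finset.univ : Finset ι₁), (((μ.real (P₁ j : Set G) : ℂ))⁻¹ • f₁ j) ∈ SchwartzBruhat G := fun j _ =>
    Submodule.smul_mem _ _ (mem_schwartzBruhat_of_kType (hU₁o j) (hU₁c j) (hP₁c j) (hUP₁ j) (hPU₁ j) (τ₁ j) (hτ₁' j) (hfP₁ j) (hf0₁ j))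
  rw [ρ.smoothTrace_sub_of_mem μ hadm ((SchwartzBruhat G).sum_mem hm₀) ((SchwartzBruhat G).sum_mem hm₁),
    ρ.smoothTrace_finset_sum_of_mem μ hadm Finset.univ hm₀, ρ.smoothTrace_finset_sum_of_mem μ hadm Finset.univ hm₁,
    Finset.sum_congr rfl fun i _ => ρ.smoothTrace_invMeasure_smul_kType μ hadm (hU₀o i) (hU₀c i) (hP₀c i) (hUP₀ i) (hPU₀ i)
      (measureReal_ne_zero_of_le μ (hU₀o i) (hP₀c i) (hUP₀ i)) (τ₀ i) (hτ₀' i) (hfP₀ i) (hf0₀ i),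
    Finset.sum_congr rfl fun j _ => ρ.smoothTrace_invMeasure_smul_kType μ hadm (hU₁o j) (hU₁c j) (hP₁c j) (hUP₁ j) (hPU₁ j)
      (measureReal_ne_zero_of_le μ (hU₁o j) (hP₁c j) (hUP₁ j)) (τ₁ j) (hτ₁' j) (hfP₁ j) (hf0₁ j)]
  have hcount := finrank_intertwiningMap_presentation_self_of_isSmooth ρ₁ ρ₀ ρ dC ε h₀ hV hd hexact hε hsplit hschur
  rw [h0, h1] at hcount
  have hcast : ((∑ i, Module.finrank ℂ ((τ₀ i).IntertwiningMap (ρ.comp (P₀ i).subtype)) : ℕ) : ℂ) =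
      ((1 + ∑ j, Module.finrank ℂ ((τ₁ j).IntertwiningMap (ρ.comp (P₁ j).subtype)) : ℕ) : ℂ) := by rw [hcount]
  rw [Nat.cast_sum, Nat.cast_add, Nat.cast_sum, Nat.cast_one] at hcast
  rw [hcast, add_sub_cancel_right]

end Representation
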